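import Mathlib
import Literature.MathematicalPhysics.QuantumFieldTheory.PottsHiggsCellularRepresentation
import HarnessLib

/-!
# The cellular representation of the Potts lattice Higgs model, II: positive association (Thm 11),
# Griffiths II (Prop 27), the perimeter law (Prop 28, lower bound) and monotonicity (Prop 29) — PROVED

Companion of `PottsHiggsCellularRepresentation` (Eldridge–Forsström–Schweinhart, arXiv:2602.22199
[EldridgeForsstromSchweinhart2026]: Definitions 1, 3, 4, 6, Theorems 5 and 7 on the torus `𝕋^d_L`,
`i = 1`; see its module docstring for the setting, the readings and the SCOPE caveat — finite
abelian lattice Higgs model, exact finite-volume statements; nothing here bears on the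
four-dimensional Yang–Mills mass gap or on `BalabanLadder.IR`; in the `ym` ladder only the
conditional finite-`𝕋⁴` rung `BalabanLadder.UV` is closed by any route).

Source loci (arXiv v1): §2.2 Def. 16 (relative Betti numbers), §4.2 **Lemma 21** (Mayer–Vietoris
inequality `b_i(X∪Y, A∪B) + b_i(X∩Y, A∩B) ≥ b_i(X,A) + b_i(Y,B)`) and **Theorem 11** (the CPP is
positively associated: the lattice condition `r^{X,Y}_{A,B} ≥ 1`), §4.3 **Proposition 24** (the
one-point conditionals of the CPP: an `i`-cell is open given the rest with probability `p₁` or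
`p₁/(r(1-p₁)+p₁)`, "adding a single cell adds a single linear equation"; whence stochastic
monotonicity in `p₂, p₁`, Theorem 13), §5 **Proposition 27** (Griffiths' second inequality
`𝔼(W_{γ₁}W_{γ₂}) ≥ 𝔼(W_{γ₁})𝔼(W_{γ₂})`), **Proposition 28** (perimeter law
`e^{-c₁|γ|} ≤ 𝔼(W_γ) ≤ e^{-c₂|γ|}` for `β₂, β₁ > 0`), **Proposition 29** (`𝔼(W_γ)` is increasing in
`β₂` and `β₁`).

## Contents (everything PROVED; no named fact is introduced)

* `relBettiOne` (Def. 16), `relBettiOne_add_le` (**Lemma 21**, by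
  `dim(U ⊓ V) + dim(U ⊔ V) = dim U + dim V`), `relCocycleCard_zmod_eq` (`|Z¹| = q^{b₁}`);
* **Theorem 11** for prime `q`: `cppWeight_mul_cppWeight_le` (FKG lattice condition),
  `cpp_positive_association` (Mathlib's four-functions `fkg` on the distributive lattice of pairs of
  finsets), `cppEventProb_inter_ge`;
* **Proposition 27**: `wilsonLoopVar_add`, `isRelNullHomologousIn_add`, `cppEventProb_mono`,
  `higgsExpect_wilsonLoopVar_re`, `higgsExpect_wilsonLoopVar_mul_ge`;
* **Proposition 28, lower bound**, for EVERY `q = n ≥ 1` (no primality: finite energy instead of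
  positive association): `relCocycleCard_le_card_mul_insert` (`|Z¹(P₂,P₁)| ≤ |M|·|Z¹(P₂,P₁∪{ε})|`),
  `cppWeight_insert_ge` (Prop. 24's one-point bound as a weight inequality), `openEdgesMass`,
  `openEdgesMass_insert_ge`, `pow_mul_cppPartitionFn_le_openEdgesMass`,
  `pow_le_cppEventProb_subset` (`ρ(S ⊆ P₁) ≥ (p₁/(p₁+|M|(1-p₁)))^{|S|}`), `chainEdges`,
  **`higgsExpect_wilsonLoopVar_ge_pow`** (`𝔼(W_γ) ≥ (p₁/(p₁+n(1-p₁)))^{|γ|}`, uniformly in the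
  volume and in `β₂`). The UPPER bound of Prop. 28 (via the Bernoulli domination of Thm. 13) is
  NOT typed. `-- TODO(general form): Prop. 28 upper bound; Thm. 13 as a coupling; Thm. 15 duality.`
* **Proposition 29** for prime `q`: `cppEventProb_mono_param` (stochastic monotonicity of `ρ` in
  `(p₂, p₁)` on increasing events — Holley's criterion replaced by Thm. 11 applied to the increasing
  density `t₂^{|P₂|} t₁^{|P₁|}`, in which the cohomological weight cancels),
  **`higgsExpect_wilsonLoopVar_mono`**.
-/

open Finset

namespace Literature.MathematicalPhysics.QuantumFieldTheory

namespace PlaquetteRC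

open LatticeForm

variable {d L : ℕ}

/-! ### Field coefficients: the relative Betti number and the Mayer–Vietoris inequality (Lemma 21) -/

section RelBetti

variable [NeZero L] (F : Type*) [Field F]

/-- The relative Betti number `b₁(P₂, P₁; F) = dim_F H¹(P₂, P₁; F) = dim_F Z¹(P₂, P₁; F)`
(Definition 16; no quotient since `C⁰(P₂,P₁) = 0`, §2.2). [cite: EldridgeForsstromSchweinhart2026, §2.2 Def. 16] -/
noncomputable def relBettiOne (ω : CppConfig d L) : ℕ :=
  Module.finrank F (relFlatCochains (d := d) (L := L) F F ω)

/-- **Lemma 21 (Mayer–Vietoris inequality for relative Betti numbers)** on the torus, `i = 1`: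
`b₁(X ∪ Y, A ∪ B) + b₁(X ∩ Y, A ∩ B) ≥ b₁(X, A) + b₁(Y, B)` for pairs `ω = (X, A)`, `ω' = (Y, B)`.
Printed proof: exactness of the relative Mayer–Vietoris sequence; here:
`Z¹(ω ⊔ ω') = Z¹(ω) ⊓ Z¹(ω')`, `Z¹(ω) ⊔ Z¹(ω') ≤ Z¹(ω ⊓ ω')` and
`dim(U ⊓ V) + dim(U ⊔ V) = dim U + dim V`. [cite: EldridgeForsstromSchweinhart2026, §4.2 Lemma 21] -/
theorem relBettiOne_add_le (ω ω' : CppConfig d L) :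
    relBettiOne F ω + relBettiOne F ω' ≤ relBettiOne F (ω ⊔ ω') + relBettiOne F (ω ⊓ ω') := by
  classical
  unfold relBettiOne
  have hdim := Submodule.finrank_sup_add_finrank_inf_eq (relFlatCochains (d := d) (L := L) F F ω)
    (relFlatCochains F F ω')
  rw [← relFlatCochains_sup] at hdim
  have hle : Module.finrank F ↥(relFlatCochains (d := d) (L := L) F F ω ⊔ relFlatCochains F F ω') ≤
      Module.finrank F (relFlatCochains (d := d) (L := L) F F (ω ⊓ ω')) :=
    Submodule.finrank_mono (sup_le_relFlatCochains_inf ω ω')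
  omega

variable (q : ℕ) [Fact q.Prime]

/-- For `𝔽_q` coefficients the relative cocycle count is `|Z¹(P₂,P₁;𝔽_q)| = q^{b₁(P₂,P₁;𝔽_q)}`
(proof of Lemma 21: "`|H^i(S,T;ℤ_q)| = q^{b_i(S,T;ℤ_q)}`"). [cite: EldridgeForsstromSchweinhart2026, §4.2 (proof of Lemma 21)] -/
theorem relCocycleCard_zmod_eq (ω : CppConfig d L) :
    relCocycleCard (d := d) (L := L) (ZMod q) ω = q ^ relBettiOne (ZMod q) ω := by
  unfold relCocycleCard relBettiOne
  have hc : Nat.card (relFlatCochains (d := d) (L := L) ℤ (ZMod q) ω) =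
      Nat.card (relFlatCochains (d := d) (L := L) (ZMod q) (ZMod q) ω) := rfl
  rw [hc, Module.natCard_eq_pow_finrank (K := ZMod q), Nat.card_zmod]

end RelBetti

/-! ### Theorem 11: the CPP is positively associated (FKG) -/

section FKG

variable [NeZero L] (q : ℕ) [Fact q.Prime]

/-- **FKG lattice condition for the CPP weights** (`q` prime, `p₂, p₁ ∈ [0,1]`):
`ρ(ω) ρ(ω') ≤ ρ(ω ⊓ ω') ρ(ω ⊔ ω')` — the cell counts are modular and the cocycle counts satisfy
Lemma 21 (this is the displayed computation `r^{X,Y}_{A,B} ≥ 1` of the proof of Theorem 11).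
[cite: EldridgeForsstromSchweinhart2026, §4.2 (proof of Thm. 11)] -/
theorem cppWeight_mul_cppWeight_le {p₂ p₁ : ℝ} (hp₂ : p₂ ∈ Set.Icc (0 : ℝ) 1)
    (hp₁ : p₁ ∈ Set.Icc (0 : ℝ) 1) (ω ω' : CppConfig d L) :
    cppWeight (ZMod q) p₂ p₁ ω * cppWeight (ZMod q) p₂ p₁ ω' ≤
      cppWeight (ZMod q) p₂ p₁ (ω ⊓ ω') * cppWeight (ZMod q) p₂ p₁ (ω ⊔ ω') := by
  classical
  have hq1 : (1 : ℝ) ≤ q := by exact_mod_cast (Fact.out : q.Prime).one_lt.le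
  -- modularity of the four cell counts
  have hc1 : ω.1.card + ω'.1.card = (ω ⊓ ω').1.card + (ω ⊔ ω').1.card := by
    rw [Prod.fst_inf, Prod.fst_sup, Finset.inf_eq_inter, Finset.sup_eq_union,
      Finset.card_inter_add_card_union]
  have hc1c : ω.1ᶜ.card + ω'.1ᶜ.card = (ω ⊓ ω').1ᶜ.card + (ω ⊔ ω').1ᶜ.card := by
    rw [Prod.fst_inf, Prod.fst_sup, Finset.inf_eq_inter, Finset.sup_eq_union, Finset.compl_inter,
      Finset.compl_union, add_comm ((ω.1ᶜ ∪ ω'.1ᶜ).card), Finset.card_inter_add_card_union]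
  have hc2 : ω.2.card + ω'.2.card = (ω ⊓ ω').2.card + (ω ⊔ ω').2.card := by
    rw [Prod.snd_inf, Prod.snd_sup, Finset.inf_eq_inter, Finset.sup_eq_union,
      Finset.card_inter_add_card_union]
  have hc2c : ω.2ᶜ.card + ω'.2ᶜ.card = (ω ⊓ ω').2ᶜ.card + (ω ⊔ ω').2ᶜ.card := by
    rw [Prod.snd_inf, Prod.snd_sup, Finset.inf_eq_inter, Finset.sup_eq_union, Finset.compl_inter,
      Finset.compl_union, add_comm ((ω.2ᶜ ∪ ω'.2ᶜ).card), Finset.card_inter_add_card_union]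
  -- Lemma 21 for the cocycle counts
  have hb := relBettiOne_add_le (ZMod q) ω ω'
  have hZ : (relCocycleCard (d := d) (L := L) (ZMod q) ω : ℝ) * relCocycleCard (ZMod q) ω' ≤
      (relCocycleCard (d := d) (L := L) (ZMod q) (ω ⊓ ω') : ℝ) * relCocycleCard (ZMod q) (ω ⊔ ω') := by
    rw [relCocycleCard_zmod_eq q ω, relCocycleCard_zmod_eq q ω', relCocycleCard_zmod_eq q (ω ⊓ ω'),
      relCocycleCard_zmod_eq q (ω ⊔ ω')]
    push_cast
    rw [← pow_add, ← pow_add, add_comm (relBettiOne (ZMod q) (ω ⊓ ω'))]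
    exact pow_le_pow_right₀ hq1 hb
  have h2 : 0 ≤ 1 - p₂ := sub_nonneg.mpr hp₂.2
  have h1 : 0 ≤ 1 - p₁ := sub_nonneg.mpr hp₁.2
  have hA : 0 ≤ p₂ ^ (ω.1.card + ω'.1.card) * (1 - p₂) ^ (ω.1ᶜ.card + ω'.1ᶜ.card) *
      (p₁ ^ (ω.2.card + ω'.2.card) * (1 - p₁) ^ (ω.2ᶜ.card + ω'.2ᶜ.card)) := by
    have := hp₂.1
    have := hp₁.1
    positivity
  unfold cppWeight
  calc p₂ ^ ω.1.card * (1 - p₂) ^ ω.1ᶜ.card * (p₁ ^ ω.2.card * (1 - p₁) ^ ω.2ᶜ.card) *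
          (relCocycleCard (ZMod q) ω : ℝ) *
        (p₂ ^ ω'.1.card * (1 - p₂) ^ ω'.1ᶜ.card * (p₁ ^ ω'.2.card * (1 - p₁) ^ ω'.2ᶜ.card) *
          (relCocycleCard (ZMod q) ω' : ℝ))
      = p₂ ^ (ω.1.card + ω'.1.card) * (1 - p₂) ^ (ω.1ᶜ.card + ω'.1ᶜ.card) *
          (p₁ ^ (ω.2.card + ω'.2.card) * (1 - p₁) ^ (ω.2ᶜ.card + ω'.2ᶜ.card)) *
          ((relCocycleCard (ZMod q) ω : ℝ) * relCocycleCard (ZMod q) ω') := by ring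
    _ ≤ p₂ ^ (ω.1.card + ω'.1.card) * (1 - p₂) ^ (ω.1ᶜ.card + ω'.1ᶜ.card) *
          (p₁ ^ (ω.2.card + ω'.2.card) * (1 - p₁) ^ (ω.2ᶜ.card + ω'.2ᶜ.card)) *
          ((relCocycleCard (ZMod q) (ω ⊓ ω') : ℝ) * relCocycleCard (ZMod q) (ω ⊔ ω')) :=
        mul_le_mul_of_nonneg_left hZ hA
    _ = p₂ ^ (ω ⊓ ω').1.card * (1 - p₂) ^ (ω ⊓ ω').1ᶜ.card *
            (p₁ ^ (ω ⊓ ω').2.card * (1 - p₁) ^ (ω ⊓ ω').2ᶜ.card) *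
            (relCocycleCard (ZMod q) (ω ⊓ ω') : ℝ) *
          (p₂ ^ (ω ⊔ ω').1.card * (1 - p₂) ^ (ω ⊔ ω').1ᶜ.card *
            (p₁ ^ (ω ⊔ ω').2.card * (1 - p₁) ^ (ω ⊔ ω').2ᶜ.card) *
            (relCocycleCard (ZMod q) (ω ⊔ ω') : ℝ)) := by
        rw [hc1, hc1c, hc2, hc2c]; ring

/-- **Theorem 11 (Eldridge–Forsström–Schweinhart 2026; positive association of the CPP)**, `q`
prime, `p₂, p₁ ∈ [0,1]`, on the torus with `i = 1`: for increasing non-negative functions `f, g`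
of the pair `(P₂, P₁)` (componentwise inclusion order), `ρ(fg) ≥ ρ(f) ρ(g)`, written without
division as `(Σ ρ f)(Σ ρ g) ≤ (Σ ρ)(Σ ρ f g)`. From the lattice condition by the four-functions
theorem (Mathlib's `fkg` on the distributive lattice of pairs of finsets).
[cite: EldridgeForsstromSchweinhart2026, §1.2 Thm. 11 and §4.2] -/
theorem cpp_positive_association {p₂ p₁ : ℝ} (hp₂ : p₂ ∈ Set.Icc (0 : ℝ) 1)
    (hp₁ : p₁ ∈ Set.Icc (0 : ℝ) 1) {f g : CppConfig d L → ℝ} (hf₀ : 0 ≤ f) (hg₀ : 0 ≤ g)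
    (hf : Monotone f) (hg : Monotone g) :
    (∑ ω, cppWeight (ZMod q) p₂ p₁ ω * f ω) * (∑ ω, cppWeight (ZMod q) p₂ p₁ ω * g ω) ≤
      (∑ ω : CppConfig d L, cppWeight (ZMod q) p₂ p₁ ω) *
        ∑ ω, cppWeight (ZMod q) p₂ p₁ ω * (f ω * g ω) := by
  classical
  exact fkg f g (cppWeight (d := d) (L := L) (ZMod q) p₂ p₁)
    (fun ω => cppWeight_nonneg (ZMod q) hp₂ hp₁ ω) hf₀ hg₀ hf hg
    (fun ω ω' => cppWeight_mul_cppWeight_le q hp₂ hp₁ ω ω')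

/-- Theorem 11 in probability form: for increasing EVENTS `E₁, E₂` of CPP configurations,
`p₂, p₁ ∈ [0,1]` with `Z_CPP > 0` (e.g. `p₂, p₁ ∈ (0,1)`, `cppPartitionFn_pos`, or
`p = 1 - e^{-β}`, `cppPartitionFn_esParam_pos`), `ρ(E₁ ∩ E₂) ≥ ρ(E₁) ρ(E₂)`.
[cite: EldridgeForsstromSchweinhart2026, §1.2 Thm. 11] -/
theorem cppEventProb_inter_ge {p₂ p₁ : ℝ} (hp₂' : p₂ ∈ Set.Icc (0 : ℝ) 1) (hp₁' : p₁ ∈ Set.Icc (0 : ℝ) 1)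
    (hZ : 0 < cppPartitionFn (d := d) (L := L) (ZMod q) p₂ p₁)
    {E₁ E₂ : Set (CppConfig d L)} (h₁ : IsUpperSet E₁) (h₂ : IsUpperSet E₂) :
    cppEventProb (ZMod q) p₂ p₁ E₁ * cppEventProb (ZMod q) p₂ p₁ E₂ ≤
      cppEventProb (ZMod q) p₂ p₁ (E₁ ∩ E₂) := by
  classical
  set f : CppConfig d L → ℝ := fun ω => if ω ∈ E₁ then 1 else 0 with hfE
  set g : CppConfig d L → ℝ := fun ω => if ω ∈ E₂ then 1 else 0 with hgE
  have hf₀ : 0 ≤ f := fun ω => by simp only [Pi.zero_apply, hfE]; split_ifs <;> norm_num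
  have hg₀ : 0 ≤ g := fun ω => by simp only [Pi.zero_apply, hgE]; split_ifs <;> norm_num
  have hf : Monotone f := by
    intro a b hab
    simp only [hfE]
    by_cases ha : a ∈ E₁
    · rw [if_pos ha, if_pos (h₁ hab ha)]
    · rw [if_neg ha]; split_ifs <;> norm_num
  have hg : Monotone g := by
    intro a b hab
    simp only [hgE]
    by_cases ha : a ∈ E₂
    · rw [if_pos ha, if_pos (h₂ hab ha)]
    · rw [if_neg ha]; split_ifs <;> norm_num
  have key := cpp_positive_association q hp₂' hp₁' hf₀ hg₀ hf hg
  have hE : ∀ (E : Set (CppConfig d L)) (h : CppConfig d L → ℝ),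
      (∀ ω, ω ∈ E → h ω = 1) → (∀ ω, ω ∉ E → h ω = 0) →
      cppEventProb (ZMod q) p₂ p₁ E =
        (∑ ω, cppWeight (ZMod q) p₂ p₁ ω * h ω) / cppPartitionFn (d := d) (L := L) (ZMod q) p₂ p₁ := by
    intro E h h1 h0
    unfold cppEventProb cppProb
    rw [Finset.sum_div]
    refine Finset.sum_congr rfl fun ω _ => ?_
    by_cases hω : ω ∈ E
    · rw [if_pos hω, h1 ω hω, mul_one]
    · rw [if_neg hω, h0 ω hω, mul_zero, zero_div]
  have hf1 : ∀ ω, ω ∈ E₁ → f ω = 1 := fun ω h => by simp only [hfE, if_pos h]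
  have hf0 : ∀ ω, ω ∉ E₁ → f ω = 0 := fun ω h => by simp only [hfE, if_neg h]
  have hg1 : ∀ ω, ω ∈ E₂ → g ω = 1 := fun ω h => by simp only [hgE, if_pos h]
  have hg0 : ∀ ω, ω ∉ E₂ → g ω = 0 := fun ω h => by simp only [hgE, if_neg h]
  have hfg1 : ∀ ω, ω ∈ E₁ ∩ E₂ → f ω * g ω = 1 := fun ω h => by
    rw [hf1 ω h.1, hg1 ω h.2, mul_one]
  have hfg0 : ∀ ω, ω ∉ E₁ ∩ E₂ → f ω * g ω = 0 := fun ω h => by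
    rcases not_and_or.mp h with h' | h'
    · rw [hf0 ω h', zero_mul]
    · rw [hg0 ω h', mul_zero]
  rw [hE E₁ f hf1 hf0, hE E₂ g hg1 hg0, hE (E₁ ∩ E₂) (fun ω => f ω * g ω) hfg1 hfg0,
    div_mul_div_comm, div_le_div_iff₀ (mul_pos hZ hZ) hZ]
  have hZeq : cppPartitionFn (d := d) (L := L) (ZMod q) p₂ p₁ =
      ∑ ω : CppConfig d L, cppWeight (ZMod q) p₂ p₁ ω := rfl
  rw [← hZeq] at key
  calc (∑ ω, cppWeight (ZMod q) p₂ p₁ ω * f ω) * (∑ ω, cppWeight (ZMod q) p₂ p₁ ω * g ω) *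
        cppPartitionFn (d := d) (L := L) (ZMod q) p₂ p₁
      ≤ (cppPartitionFn (d := d) (L := L) (ZMod q) p₂ p₁ *
          ∑ ω, cppWeight (ZMod q) p₂ p₁ ω * (f ω * g ω)) *
          cppPartitionFn (d := d) (L := L) (ZMod q) p₂ p₁ :=
        mul_le_mul_of_nonneg_right key hZ.le
    _ = (∑ ω, cppWeight (ZMod q) p₂ p₁ ω * (f ω * g ω)) *
          (cppPartitionFn (d := d) (L := L) (ZMod q) p₂ p₁ *
            cppPartitionFn (d := d) (L := L) (ZMod q) p₂ p₁) := by ring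

end FKG

/-! ### Proposition 27: Griffiths' second inequality for Wilson lines via the CPP -/

section Griffiths

variable [NeZero L] (q : ℕ) [Fact q.Prime]

/-- `f ↦ f(γ)` is additive in the chain: `f(γ₁ + γ₂) = f(γ₁) + f(γ₂)`. [cite: EldridgeForsstromSchweinhart2026, §5 (proof of Prop. 27: W_{γ₁}W_{γ₂} = W_{γ₁+γ₂})] -/
theorem pairing_add_right' {R : Type*} [CommRing R] (θ γ₁ γ₂ : Site d L → Fin d → R) :
    pairing θ (γ₁ + γ₂) = pairing θ γ₁ + pairing θ γ₂ := by
  unfold pairing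
  simp only [Pi.add_apply, mul_add, Finset.sum_add_distrib]

/-- `W_{γ₁} W_{γ₂} = W_{γ₁+γ₂}`. [cite: EldridgeForsstromSchweinhart2026, §5 (proof of Prop. 27)] -/
theorem wilsonLoopVar_add (γ₁ γ₂ θ : Site d L → Fin d → ZMod q) :
    wilsonLoopVar q (γ₁ + γ₂) θ = wilsonLoopVar q γ₁ θ * wilsonLoopVar q γ₂ θ := by
  simp only [wilsonLoopVar, pairing_add_right', AddChar.map_add_eq_mul]

/-- `V_{γ₁} ∩ V_{γ₂} ⊆ V_{γ₁+γ₂}` (relative boundaries form a group). [cite: EldridgeForsstromSchweinhart2026, §5 (proof of Prop. 27)] -/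
theorem isRelNullHomologousIn_add {R : Type*} [CommRing R] {ω : CppConfig d L}
    {γ₁ γ₂ : Site d L → Fin d → R} (h₁ : IsRelNullHomologousIn R ω γ₁)
    (h₂ : IsRelNullHomologousIn R ω γ₂) : IsRelNullHomologousIn R ω (γ₁ + γ₂) :=
  (relBoundaryChains R ω).add_mem h₁ h₂

/-- The CPP probability of an event is monotone in the event (`p₂, p₁ ∈ [0,1]`).
[cite: EldridgeForsstromSchweinhart2026, §1.1 Def. 4] -/
theorem cppEventProb_mono {M : Type*} [AddCommGroup M] [Fintype M] {p₂ p₁ : ℝ}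
    (hp₂ : p₂ ∈ Set.Icc (0 : ℝ) 1) (hp₁ : p₁ ∈ Set.Icc (0 : ℝ) 1) {E₁ E₂ : Set (CppConfig d L)}
    (h : E₁ ⊆ E₂) : cppEventProb (d := d) (L := L) M p₂ p₁ E₁ ≤ cppEventProb M p₂ p₁ E₂ := by
  classical
  unfold cppEventProb
  refine Finset.sum_le_sum fun ω _ => ?_
  have hω : 0 ≤ cppProb (d := d) (L := L) M p₂ p₁ ω := by
    unfold cppProb cppPartitionFn
    exact div_nonneg (cppWeight_nonneg M hp₂ hp₁ ω)
      (Finset.sum_nonneg fun ω' _ => cppWeight_nonneg M hp₂ hp₁ ω')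
  by_cases h1 : ω ∈ E₁
  · rw [if_pos h1, if_pos (h h1)]
  · rw [if_neg h1]
    split_ifs
    · exact hω
    · exact le_rfl

/-- The Wilson line expectation is REAL and equals the CPP probability of `V_γ` (Theorem 7, real
form, `β₂, β₁` arbitrary). [cite: EldridgeForsstromSchweinhart2026, §1.2 Thm. 7] -/
theorem higgsExpect_wilsonLoopVar_re (β₂ β₁ : ℝ) (γ : Site d L → Fin d → ZMod q) :
    (higgsExpect (d := d) (L := L) (ZMod q) β₂ β₁ (wilsonLoopVar q γ)).re =
      cppEventProb (d := d) (L := L) (ZMod q) (esParam β₂) (esParam β₁)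
        {ω | IsRelNullHomologousIn (ZMod q) ω γ} := by
  rw [higgsExpect_wilsonLoopVar_eq_cppEventProb, Complex.ofReal_re]

/-- **Proposition 27 (Griffiths' second inequality for Wilson line∕loop variables of the Potts
lattice Higgs model)**, `q` prime, `β₂, β₁ ≥ 0`, on the torus: for all `1`-chains `γ₁, γ₂`,
`𝔼_μ(W_{γ₁} W_{γ₂}) ≥ 𝔼_μ(W_{γ₁}) 𝔼_μ(W_{γ₂})` (all three expectations are real, Thm. 7). Printed
proof: `𝔼(W_{γ₁})𝔼(W_{γ₂}) = ρ(V_{γ₁})ρ(V_{γ₂}) ≤ ρ(V_{γ₁} ∩ V_{γ₂}) ≤ ρ(V_{γ₁+γ₂}) = 𝔼(W_{γ₁}W_{γ₂})`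
(Theorems 7 and 11, `V_{γ₁} ∩ V_{γ₂} ⊆ V_{γ₁+γ₂}`, `W_{γ₁}W_{γ₂} = W_{γ₁+γ₂}`).
[cite: EldridgeForsstromSchweinhart2026, §5 Prop. 27] -/
theorem higgsExpect_wilsonLoopVar_mul_ge {β₂ β₁ : ℝ} (hβ₂ : 0 ≤ β₂) (hβ₁ : 0 ≤ β₁)
    (γ₁ γ₂ : Site d L → Fin d → ZMod q) :
    (higgsExpect (d := d) (L := L) (ZMod q) β₂ β₁ (wilsonLoopVar q γ₁)).re *
        (higgsExpect (d := d) (L := L) (ZMod q) β₂ β₁ (wilsonLoopVar q γ₂)).re ≤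
      (higgsExpect (d := d) (L := L) (ZMod q) β₂ β₁
        (fun θ => wilsonLoopVar q γ₁ θ * wilsonLoopVar q γ₂ θ)).re := by
  have hW : (fun θ => wilsonLoopVar q γ₁ θ * wilsonLoopVar q γ₂ θ) = wilsonLoopVar q (γ₁ + γ₂) :=
    funext fun θ => (wilsonLoopVar_add q γ₁ γ₂ θ).symm
  rw [hW, higgsExpect_wilsonLoopVar_re, higgsExpect_wilsonLoopVar_re, higgsExpect_wilsonLoopVar_re]
  have hp₂ : esParam β₂ ∈ Set.Icc (0 : ℝ) 1 := ⟨(esParam_mem_Ico hβ₂).1, (esParam_mem_Ico hβ₂).2.le⟩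
  have hp₁ : esParam β₁ ∈ Set.Icc (0 : ℝ) 1 := ⟨(esParam_mem_Ico hβ₁).1, (esParam_mem_Ico hβ₁).2.le⟩
  have hup : ∀ γ : Site d L → Fin d → ZMod q,
      IsUpperSet {ω : CppConfig d L | IsRelNullHomologousIn (ZMod q) ω γ} :=
    fun γ ω ω' hle hω => IsRelNullHomologousIn.mono (ZMod q) hle hω
  have hsub : {ω : CppConfig d L | IsRelNullHomologousIn (ZMod q) ω γ₁} ∩
      {ω | IsRelNullHomologousIn (ZMod q) ω γ₂} ⊆ {ω | IsRelNullHomologousIn (ZMod q) ω (γ₁ + γ₂)} :=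
    fun ω hω => isRelNullHomologousIn_add hω.1 hω.2
  exact (cppEventProb_inter_ge q hp₂ hp₁ (cppPartitionFn_esParam_pos (ZMod q) β₂ β₁) (hup γ₁)
    (hup γ₂)).trans (cppEventProb_mono hp₂ hp₁ hsub)

end Griffiths

/-! ### Proposition 28 (lower bound): the perimeter law for Wilson lines, by finite energy -/

section PerimeterLaw

variable [NeZero L] (M : Type*) [AddCommGroup M] [Fintype M]

omit [NeZero L] in
/-- **One more open edge costs at most a factor `|M|` in compatible cochains**:
`|Z¹(P₂, P₁; M)| ≤ |M| · |Z¹(P₂, P₁ ∪ {ε}; M)|` — "adding a single `i`-cell to `P₁` adds a single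
linear equation" (proof of Prop. 24); here: `Z¹(P₂,P₁∪{ε})` is the kernel of the evaluation
`Z¹(P₂,P₁) → M` at `ε`, whose image has at most `|M|` elements. [cite: EldridgeForsstromSchweinhart2026, §4.3 (proof of Prop. 24)] -/
theorem relCocycleCard_le_card_mul_insert (ω : CppConfig d L) (e : Site d L × Fin d) :
    relCocycleCard M ω ≤ Fintype.card M * relCocycleCard M (ω.1, insert e ω.2) := by
  classical
  set Z := relFlatCochains (d := d) (L := L) ℤ M ω with hZdef
  set Z' := relFlatCochains (d := d) (L := L) ℤ M (ω.1, insert e ω.2) with hZ'def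
  -- evaluation at the edge `e`, restricted to `Z`
  set ev : (Site d L → Fin d → M) →ₗ[ℤ] M :=
    (LinearMap.proj (R := ℤ) (φ := fun _ : Fin d => M) e.2).comp
      (LinearMap.proj (R := ℤ) (φ := fun _ : Site d L => Fin d → M) e.1) with hev
  set f : Z →ₗ[ℤ] M := ev.comp Z.subtype with hf
  have hfapply : ∀ z : Z, f z = (z : Site d L → Fin d → M) e.1 e.2 := fun z => rfl
  have hker : ∀ z : Z, z ∈ LinearMap.ker f ↔ (z : Site d L → Fin d → M) e.1 e.2 = 0 := fun z => by
    rw [LinearMap.mem_ker, hfapply]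
  -- `ker f ≃ Z'`
  have φ : LinearMap.ker f ≃ Z' :=
  { toFun := fun z => ⟨(z.1 : Site d L → Fin d → M), ⟨z.1.2.1, fun e' he' => by
        rcases Finset.mem_insert.mp he' with rfl | he'
        · exact (hker z.1).mp z.2
        · exact z.1.2.2 e' he'⟩⟩
    invFun := fun θ => ⟨⟨θ.1, ⟨θ.2.1, fun e' he' => θ.2.2 e' (Finset.mem_insert_of_mem he')⟩⟩,
        (hker _).mpr (θ.2.2 e (Finset.mem_insert_self e ω.2))⟩
    left_inv := fun _ => rfl
    right_inv := fun _ => rfl }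
  have h1 : Nat.card Z = Nat.card (LinearMap.ker f) * Nat.card (Z ⧸ LinearMap.ker f) :=
    Submodule.card_eq_card_quotient_mul_card _
  have h2 : Nat.card (Z ⧸ LinearMap.ker f) = Nat.card (LinearMap.range f) :=
    Nat.card_congr f.quotKerEquivRange.toEquiv
  have h3 : Nat.card (LinearMap.range f) ≤ Fintype.card M := by
    rw [← Nat.card_eq_fintype_card]
    exact Nat.card_le_card_of_injective (fun x : LinearMap.range f => (x : M)) Subtype.val_injective
  have h4 : Nat.card (LinearMap.ker f) = Nat.card Z' := Nat.card_congr φ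
  show Nat.card Z ≤ Fintype.card M * Nat.card Z'
  rw [h1, h4, h2, mul_comm]
  exact Nat.mul_le_mul_right _ h3

/-- **Finite energy for edges** (the one-point conditional of Prop. 24 with `r = |M|`, as an
inequality between weights): for a closed edge `ε ∉ P₁` and `p₂, p₁ ∈ [0,1]`,
`p₁ · ρ-weight(P₂, P₁) ≤ (1-p₁)|M| · ρ-weight(P₂, P₁ ∪ {ε})`, i.e.
`ρ(ε open ∣ rest) ≥ p₁/(p₁ + |M|(1-p₁))`. [cite: EldridgeForsstromSchweinhart2026, §4.3 Prop. 24 (one-point conditionals)] -/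
theorem cppWeight_insert_ge {p₂ p₁ : ℝ} (hp₂ : p₂ ∈ Set.Icc (0 : ℝ) 1)
    (hp₁ : p₁ ∈ Set.Icc (0 : ℝ) 1) (ω : CppConfig d L) {e : Site d L × Fin d} (he : e ∉ ω.2) :
    p₁ * cppWeight (d := d) (L := L) M p₂ p₁ ω ≤
      (1 - p₁) * Fintype.card M * cppWeight (d := d) (L := L) M p₂ p₁ (ω.1, insert e ω.2) := by
  classical
  have hcard : (insert e ω.2).card = ω.2.card + 1 := Finset.card_insert_of_notMem he
  have hcardc : ω.2ᶜ.card = (insert e ω.2)ᶜ.card + 1 := by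
    rw [Finset.compl_insert, Finset.card_erase_add_one (Finset.mem_compl.mpr he)]
  have hZ : (relCocycleCard (d := d) (L := L) M ω : ℝ) ≤
      Fintype.card M * relCocycleCard (d := d) (L := L) M (ω.1, insert e ω.2) := by
    exact_mod_cast relCocycleCard_le_card_mul_insert M ω e
  have h2 : 0 ≤ 1 - p₂ := sub_nonneg.mpr hp₂.2
  have h1 : 0 ≤ 1 - p₁ := sub_nonneg.mpr hp₁.2
  have hA : 0 ≤ p₂ ^ ω.1.card * (1 - p₂) ^ ω.1ᶜ.card *
      (p₁ ^ (ω.2.card + 1) * (1 - p₁) ^ ((insert e ω.2)ᶜ.card + 1)) := by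
    have := hp₂.1
    have := hp₁.1
    positivity
  unfold cppWeight
  simp only
  rw [hcard, hcardc]
  calc p₁ * (p₂ ^ ω.1.card * (1 - p₂) ^ ω.1ᶜ.card *
          (p₁ ^ ω.2.card * (1 - p₁) ^ ((insert e ω.2)ᶜ.card + 1)) * (relCocycleCard M ω : ℝ))
      = p₂ ^ ω.1.card * (1 - p₂) ^ ω.1ᶜ.card *
          (p₁ ^ (ω.2.card + 1) * (1 - p₁) ^ ((insert e ω.2)ᶜ.card + 1)) *
          (relCocycleCard M ω : ℝ) := by ring
    _ ≤ p₂ ^ ω.1.card * (1 - p₂) ^ ω.1ᶜ.card *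
          (p₁ ^ (ω.2.card + 1) * (1 - p₁) ^ ((insert e ω.2)ᶜ.card + 1)) *
          (Fintype.card M * relCocycleCard (d := d) (L := L) M (ω.1, insert e ω.2) : ℝ) :=
        mul_le_mul_of_nonneg_left hZ hA
    _ = (1 - p₁) * Fintype.card M * (p₂ ^ ω.1.card * (1 - p₂) ^ ω.1ᶜ.card *
          (p₁ ^ (ω.2.card + 1) * (1 - p₁) ^ (insert e ω.2)ᶜ.card) *
          (relCocycleCard (d := d) (L := L) M (ω.1, insert e ω.2) : ℝ)) := by ring

/-- The unnormalised CPP mass of the increasing event "`S ⊆ P₁`" (all edges of `S` open).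
[cite: EldridgeForsstromSchweinhart2026, §5 (proof of Prop. 28: the events A_j)] -/
noncomputable def openEdgesMass (p₂ p₁ : ℝ) (S : Finset (Site d L × Fin d)) : ℝ :=
  ∑ ω : CppConfig d L, if S ⊆ ω.2 then cppWeight (d := d) (L := L) M p₂ p₁ ω else 0

omit [Fintype M] in
/-- `openEdgesMass ∅ = Z_CPP`. [cite: EldridgeForsstromSchweinhart2026, §5 (proof of Prop. 28)] -/
theorem openEdgesMass_empty (p₂ p₁ : ℝ) :
    openEdgesMass (d := d) (L := L) M p₂ p₁ ∅ = cppPartitionFn (d := d) (L := L) M p₂ p₁ := by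
  unfold openEdgesMass cppPartitionFn
  exact Finset.sum_congr rfl fun ω _ => by rw [if_pos (Finset.empty_subset _)]

/-- **One more required open edge costs at most the finite-energy factor**: for `ε ∉ S`,
`p₁ · mass(S ⊆ P₁) ≤ (p₁ + (1-p₁)|M|) · mass(S ∪ {ε} ⊆ P₁)` (split `{S ⊆ P₁}` according to
`ε ∈ P₁`; on the part with `ε` closed, open it: an injection into `{S ∪ {ε} ⊆ P₁}` which loses at
most the factor of `cppWeight_insert_ge`). [cite: EldridgeForsstromSchweinhart2026, §5 (proof of Prop. 28, lower bound) with §4.3 Prop. 24] -/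
theorem openEdgesMass_insert_ge {p₂ p₁ : ℝ} (hp₂ : p₂ ∈ Set.Icc (0 : ℝ) 1)
    (hp₁ : p₁ ∈ Set.Icc (0 : ℝ) 1) {S : Finset (Site d L × Fin d)} {e : Site d L × Fin d}
    (he : e ∉ S) :
    p₁ * openEdgesMass (d := d) (L := L) M p₂ p₁ S ≤
      (p₁ + (1 - p₁) * Fintype.card M) * openEdgesMass (d := d) (L := L) M p₂ p₁ (insert e S) := by
  classical
  set w := cppWeight (d := d) (L := L) M p₂ p₁ with hw
  -- split `{S ⊆ P₁}` into `{S ∪ {e} ⊆ P₁}` and `{S ⊆ P₁, e ∉ P₁}`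
  set U₁ : ℝ := ∑ ω : CppConfig d L, if insert e S ⊆ ω.2 then w ω else 0 with hU₁
  set U₀ : ℝ := ∑ ω : CppConfig d L, if S ⊆ ω.2 ∧ e ∉ ω.2 then w ω else 0 with hU₀
  have hsplit : openEdgesMass (d := d) (L := L) M p₂ p₁ S = U₁ + U₀ := by
    rw [openEdgesMass, hU₁, hU₀, ← Finset.sum_add_distrib]
    refine Finset.sum_congr rfl fun ω _ => ?_
    by_cases hS : S ⊆ ω.2
    · by_cases heω : e ∈ ω.2
      · rw [if_pos hS, if_pos (Finset.insert_subset_iff.mpr ⟨heω, hS⟩),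
          if_neg (fun h => h.2 heω), add_zero]
      · rw [if_pos hS, if_neg (fun h => heω (Finset.insert_subset_iff.mp h).1),
          if_pos ⟨hS, heω⟩, zero_add]
    · rw [if_neg hS, if_neg (fun h => hS (Finset.insert_subset_iff.mp h).2),
        if_neg (fun h => hS h.1), add_zero]
  have hU₁eq : openEdgesMass (d := d) (L := L) M p₂ p₁ (insert e S) = U₁ := rfl
  -- finite energy, summed over the injection `ω ↦ (ω.1, insert e ω.2)`
  have hU₀le : p₁ * U₀ ≤ (1 - p₁) * Fintype.card M * U₁ := by
    have hle : p₁ * U₀ ≤ ∑ ω : CppConfig d L, if S ⊆ ω.2 ∧ e ∉ ω.2 then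
        (1 - p₁) * Fintype.card M * w (ω.1, insert e ω.2) else 0 := by
      rw [hU₀, Finset.mul_sum]
      refine Finset.sum_le_sum fun ω _ => ?_
      split_ifs with h
      · exact cppWeight_insert_ge M hp₂ hp₁ ω h.2
      · rw [mul_zero]
    refine hle.trans (le_of_eq ?_)
    rw [hU₁, Finset.mul_sum]
    simp_rw [mul_ite, mul_zero]
    -- reindex: `{S ⊆ P₁, e ∉ P₁} ≃ {S ∪ {e} ⊆ P₁}` by `P₁ ↦ P₁ ∪ {e}`, inverse `P₁ ↦ P₁ \ {e}`
    rw [← Finset.sum_filter, ← Finset.sum_filter]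
    refine Finset.sum_nbij' (fun ω : CppConfig d L => (ω.1, insert e ω.2))
      (fun ω : CppConfig d L => (ω.1, ω.2.erase e)) ?_ ?_ ?_ ?_ ?_
    · intro ω hω
      simp only [Finset.mem_filter, Finset.mem_univ, true_and] at hω ⊢
      exact Finset.insert_subset_insert e hω.1
    · intro ω hω
      simp only [Finset.mem_filter, Finset.mem_univ, true_and] at hω ⊢
      obtain ⟨heω, hSω⟩ := Finset.insert_subset_iff.mp hω
      exact ⟨fun x hx => Finset.mem_erase.mpr ⟨fun hxe => he (hxe ▸ hx), hSω hx⟩,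
        Finset.notMem_erase e ω.2⟩
    · intro ω hω
      simp only [Finset.mem_filter, Finset.mem_univ, true_and] at hω
      ext <;> simp [Finset.erase_insert hω.2]
    · intro ω hω
      simp only [Finset.mem_filter, Finset.mem_univ, true_and] at hω
      ext <;> simp [Finset.insert_erase (Finset.insert_subset_iff.mp hω).1]
    · intro ω _
      rfl
  rw [hsplit, hU₁eq]
  nlinarith [hU₀le]

omit [Fintype M] in
/-- The mass of `{S ⊆ P₁}` is non-negative. [cite: EldridgeForsstromSchweinhart2026, §1.1 Def. 4] -/
theorem openEdgesMass_nonneg {p₂ p₁ : ℝ} (hp₂ : p₂ ∈ Set.Icc (0 : ℝ) 1) (hp₁ : p₁ ∈ Set.Icc (0 : ℝ) 1)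
    (S : Finset (Site d L × Fin d)) : 0 ≤ openEdgesMass (d := d) (L := L) M p₂ p₁ S := by
  classical
  unfold openEdgesMass
  refine Finset.sum_nonneg fun ω _ => ?_
  split_ifs
  · exact cppWeight_nonneg M hp₂ hp₁ ω
  · exact le_rfl

/-- `α^{|S|} · Z_CPP ≤ mass(S ⊆ P₁)`, `α = p₁/(p₁ + (1-p₁)|M|)`, by induction on `S` from
`openEdgesMass_insert_ge`. [cite: EldridgeForsstromSchweinhart2026, §5 (proof of Prop. 28, lower bound)] -/
theorem pow_mul_cppPartitionFn_le_openEdgesMass {p₂ p₁ : ℝ} (hp₂ : p₂ ∈ Set.Icc (0 : ℝ) 1)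
    (hp₁ : p₁ ∈ Set.Icc (0 : ℝ) 1) (S : Finset (Site d L × Fin d)) :
    (p₁ / (p₁ + (1 - p₁) * Fintype.card M)) ^ S.card * cppPartitionFn (d := d) (L := L) M p₂ p₁ ≤
      openEdgesMass (d := d) (L := L) M p₂ p₁ S := by
  classical
  have hMpos : (0 : ℝ) < Fintype.card M := by exact_mod_cast Fintype.card_pos
  have hden : 0 < p₁ + (1 - p₁) * Fintype.card M := by
    rcases hp₁.1.eq_or_lt with h0 | h0
    · rw [← h0]; simpa using hMpos
    · have : 0 ≤ (1 - p₁) * Fintype.card M := mul_nonneg (sub_nonneg.mpr hp₁.2) hMpos.le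
      linarith
  induction S using Finset.induction_on with
  | empty => rw [Finset.card_empty, pow_zero, one_mul, openEdgesMass_empty]
  | insert e S he ih =>
    rw [Finset.card_insert_of_notMem he, pow_succ, mul_comm _ (p₁ / _), mul_assoc]
    have hstep := openEdgesMass_insert_ge M hp₂ hp₁ (p₂ := p₂) he
    calc p₁ / (p₁ + (1 - p₁) * Fintype.card M) *
          ((p₁ / (p₁ + (1 - p₁) * Fintype.card M)) ^ S.card * cppPartitionFn (d := d) (L := L) M p₂ p₁)
        ≤ p₁ / (p₁ + (1 - p₁) * Fintype.card M) * openEdgesMass (d := d) (L := L) M p₂ p₁ S :=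
          mul_le_mul_of_nonneg_left ih (div_nonneg hp₁.1 hden.le)
      _ = p₁ * openEdgesMass (d := d) (L := L) M p₂ p₁ S / (p₁ + (1 - p₁) * Fintype.card M) := by
          ring
      _ ≤ openEdgesMass (d := d) (L := L) M p₂ p₁ (insert e S) := by
          rw [div_le_iff₀ hden, mul_comm (openEdgesMass M p₂ p₁ (insert e S))]
          exact hstep

/-- **All edges of `S` are open with probability at least `α^{|S|}`**,
`α = p₁/(p₁ + |M|(1-p₁))` (positive for `p₁ > 0`): `ρ(S ⊆ P₁) ≥ α^{|S|}` — the source's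
"`ρ(∩ A_j) > (p₁/q)^n`" in the proof of Prop. 28 (note `α ≥ p₁/|M|`), here from finite energy.
Requires `p₂, p₁ ∈ [0,1]` and `Z_CPP > 0`. [cite: EldridgeForsstromSchweinhart2026, §5 (proof of Prop. 28, lower bound)] -/
theorem pow_le_cppEventProb_subset {p₂ p₁ : ℝ} (hp₂ : p₂ ∈ Set.Icc (0 : ℝ) 1)
    (hp₁ : p₁ ∈ Set.Icc (0 : ℝ) 1) (hZ : 0 < cppPartitionFn (d := d) (L := L) M p₂ p₁)
    (S : Finset (Site d L × Fin d)) :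
    (p₁ / (p₁ + (1 - p₁) * Fintype.card M)) ^ S.card ≤
      cppEventProb (d := d) (L := L) M p₂ p₁ {ω | S ⊆ ω.2} := by
  classical
  have hE : cppEventProb (d := d) (L := L) M p₂ p₁ {ω | S ⊆ ω.2} =
      openEdgesMass (d := d) (L := L) M p₂ p₁ S / cppPartitionFn (d := d) (L := L) M p₂ p₁ := by
    unfold cppEventProb openEdgesMass cppProb
    rw [Finset.sum_div]
    refine Finset.sum_congr rfl fun ω _ => ?_
    simp only [Set.mem_setOf_eq]
    split_ifs <;> simp
  rw [hE, le_div_iff₀ hZ]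
  exact pow_mul_cppPartitionFn_le_openEdgesMass M hp₂ hp₁ S

/-- The support of a `1`-chain (the edges it uses; `|γ|` = its cardinality, the "perimeter").
[cite: EldridgeForsstromSchweinhart2026, §5 Prop. 28 ("the number of i-cells in the support of γ")] -/
def chainEdges {R : Type*} [Zero R] [DecidableEq R] (γ : Site d L → Fin d → R) :
    Finset (Site d L × Fin d) :=
  Finset.univ.filter fun e => γ e.1 e.2 ≠ 0

/-- If every edge of `γ` is open then `V_γ` holds (take `τ = 0`): `{supp γ ⊆ P₁} ⊆ V_γ`.
[cite: EldridgeForsstromSchweinhart2026, §5 (proof of Prop. 28: "∩ A_j ⊂ V_γ")] -/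
theorem isRelNullHomologousIn_of_chainEdges_subset {R : Type*} [CommRing R] [DecidableEq R]
    {ω : CppConfig d L} {γ : Site d L → Fin d → R} (h : chainEdges γ ⊆ ω.2) :
    IsRelNullHomologousIn R ω γ := by
  refine ⟨0, fun _ _ => rfl, fun e he => ?_⟩
  have hγ : γ e.1 e.2 = 0 := by
    by_contra hne
    exact he (h (Finset.mem_filter.mpr ⟨Finset.mem_univ e, hne⟩))
  simp only [hγ, bd₂, Pi.zero_apply, zero_mul, Finset.sum_const_zero]

variable (n : ℕ) [NeZero n]

/-- **Proposition 28, lower bound (perimeter law for Wilson lines of the Potts lattice Higgs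
model)** on the torus, every `q = n ≥ 1`, `β₂ ≥ 0`, `β₁ ≥ 0`: with `p₁ = 1 - e^{-β₁}`,
`𝔼_μ(W_γ) ≥ (p₁/(p₁ + n(1-p₁)))^{|γ|} ≥ (p₁/n)^{|γ|} = e^{-log(n/p₁)|γ|}`, `|γ|` the number of
edges in the support of `γ` — uniformly in the volume and in `β₂`. Printed proof: `𝔼(W_γ) = ρ(V_γ)
≥ ρ(∩_j A_j)`, `A_j` = "the `j`-th edge of `γ` is open" (Thm. 7), and the one-point conditional
`≥ p₁/(q(1-p₁)+p₁)` of Prop. 24 (the source quotes positive association for the last step; finite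
energy suffices and is what is proved here). The matching UPPER bound `≤ e^{-c₂|γ|}` of Prop. 28
uses the stochastic domination of Thm. 13 and is not typed here.
[cite: EldridgeForsstromSchweinhart2026, §5 Prop. 28 (lower bound)] -/
theorem higgsExpect_wilsonLoopVar_ge_pow {β₂ β₁ : ℝ} (hβ₂ : 0 ≤ β₂) (hβ₁ : 0 ≤ β₁)
    (γ : Site d L → Fin d → ZMod n) :
    (esParam β₁ / (esParam β₁ + (1 - esParam β₁) * n)) ^ (chainEdges γ).card ≤
      (higgsExpect (d := d) (L := L) (ZMod n) β₂ β₁ (wilsonLoopVar n γ)).re := by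
  classical
  rw [higgsExpect_wilsonLoopVar_eq_cppEventProb, Complex.ofReal_re]
  have hp₂ : esParam β₂ ∈ Set.Icc (0 : ℝ) 1 := ⟨(esParam_mem_Ico hβ₂).1, (esParam_mem_Ico hβ₂).2.le⟩
  have hp₁ : esParam β₁ ∈ Set.Icc (0 : ℝ) 1 := ⟨(esParam_mem_Ico hβ₁).1, (esParam_mem_Ico hβ₁).2.le⟩
  have h := pow_le_cppEventProb_subset (ZMod n) hp₂ hp₁
    (cppPartitionFn_esParam_pos (ZMod n) β₂ β₁) (chainEdges γ)
  rw [ZMod.card n] at h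
  refine h.trans (cppEventProb_mono hp₂ hp₁ fun ω hω => ?_)
  exact isRelNullHomologousIn_of_chainEdges_subset hω

end PerimeterLaw

/-! ### Proposition 29: Wilson lines are increasing in `β₂` and `β₁` (Holley via FKG) -/

section Monotone

variable [NeZero L] (q : ℕ) [Fact q.Prime]

/-- **Stochastic monotonicity of the CPP in the parameters, for increasing events** (the part of
Theorem 13 ∕ Proposition 24 used in Prop. 29: "`ρ` is stochastically increasing in `p₂` and in
`p₁`"), `q` prime, all parameters in `(0,1)`: for `p₂ ≤ p₂'`, `p₁ ≤ p₁'` and an increasing event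
`E`, `ρ_{p₂,p₁}(E) ≤ ρ_{p₂',p₁'}(E)`. Proof here (Holley's criterion replaced by the FKG inequality
of Thm. 11): the density `ρ_{p'}/ρ_p ∝ t₂^{|P₂|} t₁^{|P₁|}`, `t = p'(1-p)/(p(1-p')) ≥ 1`, is
increasing — the cohomological factor cancels. [cite: EldridgeForsstromSchweinhart2026, §1.2 Thm. 13 (last sentence) and §4.3 Prop. 24] -/
theorem cppEventProb_mono_param {p₂ p₁ p₂' p₁' : ℝ} (hp₂ : p₂ ∈ Set.Ioo (0 : ℝ) 1)
    (hp₁ : p₁ ∈ Set.Ioo (0 : ℝ) 1) (hp₂' : p₂' ∈ Set.Ioo (0 : ℝ) 1) (hp₁' : p₁' ∈ Set.Ioo (0 : ℝ) 1)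
    (h₂ : p₂ ≤ p₂') (h₁ : p₁ ≤ p₁') {E : Set (CppConfig d L)} (hE : IsUpperSet E) :
    cppEventProb (d := d) (L := L) (ZMod q) p₂ p₁ E ≤ cppEventProb (ZMod q) p₂' p₁' E := by
  classical
  -- the density `g = t₂^{|P₂|} t₁^{|P₁|}` and the constant `K` with `w' = K · w · g`
  set t₂ : ℝ := p₂' * (1 - p₂) / (p₂ * (1 - p₂')) with ht₂
  set t₁ : ℝ := p₁' * (1 - p₁) / (p₁ * (1 - p₁')) with ht₁
  set K : ℝ := ((1 - p₂') / (1 - p₂)) ^ Fintype.card (Plaquette d L) *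
    ((1 - p₁') / (1 - p₁)) ^ Fintype.card (Site d L × Fin d) with hK
  have h2pos : 0 < 1 - p₂ := sub_pos.mpr hp₂.2
  have h2pos' : 0 < 1 - p₂' := sub_pos.mpr hp₂'.2
  have h1pos : 0 < 1 - p₁ := sub_pos.mpr hp₁.2
  have h1pos' : 0 < 1 - p₁' := sub_pos.mpr hp₁'.2
  have ht₂1 : 1 ≤ t₂ := by
    rw [ht₂, le_div_iff₀ (mul_pos hp₂.1 h2pos'), one_mul]
    nlinarith [hp₂.1, hp₂'.1]
  have ht₁1 : 1 ≤ t₁ := by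
    rw [ht₁, le_div_iff₀ (mul_pos hp₁.1 h1pos'), one_mul]
    nlinarith [hp₁.1, hp₁'.1]
  have hKpos : 0 < K := by rw [hK]; positivity
  set g : CppConfig d L → ℝ := fun ω => t₂ ^ ω.1.card * t₁ ^ ω.2.card with hg
  have hg₀ : 0 ≤ g := fun ω => by
    simp only [hg, Pi.zero_apply]
    exact mul_nonneg (pow_nonneg (zero_le_one.trans ht₂1) _) (pow_nonneg (zero_le_one.trans ht₁1) _)
  have hgmono : Monotone g := by
    intro ω ω' hle
    simp only [hg]
    exact mul_le_mul (pow_le_pow_right₀ ht₂1 (Finset.card_le_card hle.1))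
      (pow_le_pow_right₀ ht₁1 (Finset.card_le_card hle.2)) (pow_nonneg (zero_le_one.trans ht₁1) _)
      (pow_nonneg (zero_le_one.trans ht₂1) _)
  -- `w'(ω) = K · w(ω) · g(ω)`
  have hww : ∀ ω : CppConfig d L, cppWeight (d := d) (L := L) (ZMod q) p₂' p₁' ω =
      K * (cppWeight (d := d) (L := L) (ZMod q) p₂ p₁ ω * g ω) := by
    intro ω
    have hc2 : (ω.1ᶜ.card : ℕ) = Fintype.card (Plaquette d L) - ω.1.card := Finset.card_compl _
    have hc1 : (ω.2ᶜ.card : ℕ) = Fintype.card (Site d L × Fin d) - ω.2.card := Finset.card_compl _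
    have hle2 : ω.1.card ≤ Fintype.card (Plaquette d L) := Finset.card_le_univ _
    have hle1 : ω.2.card ≤ Fintype.card (Site d L × Fin d) := Finset.card_le_univ _
    obtain ⟨a, ha⟩ := Nat.exists_eq_add_of_le hle2
    obtain ⟨b, hb⟩ := Nat.exists_eq_add_of_le hle1
    unfold cppWeight
    simp only [hg]
    rw [hc2, hc1, hK, ha, hb, Nat.add_sub_cancel_left, Nat.add_sub_cancel_left, ht₂, ht₁]
    rw [div_pow, div_pow, div_pow, div_pow, mul_pow, mul_pow, mul_pow, mul_pow, pow_add, pow_add,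
      pow_add, pow_add]
    have hp2ne : p₂ ^ ω.1.card ≠ 0 := pow_ne_zero _ hp₂.1.ne'
    have hp1ne : p₁ ^ ω.2.card ≠ 0 := pow_ne_zero _ hp₁.1.ne'
    have hq2ne : (1 - p₂) ^ ω.1.card ≠ 0 := pow_ne_zero _ h2pos.ne'
    have hq2ne' : (1 - p₂) ^ a ≠ 0 := pow_ne_zero _ h2pos.ne'
    have hq1ne : (1 - p₁) ^ ω.2.card ≠ 0 := pow_ne_zero _ h1pos.ne'
    have hq1ne' : (1 - p₁) ^ b ≠ 0 := pow_ne_zero _ h1pos.ne'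
    have hr2ne : (1 - p₂') ^ ω.1.card ≠ 0 := pow_ne_zero _ h2pos'.ne'
    have hr1ne : (1 - p₁') ^ ω.2.card ≠ 0 := pow_ne_zero _ h1pos'.ne'
    field_simp
  -- FKG for `ρ_p` with `f = 𝟙_E`, `g`
  set w := cppWeight (d := d) (L := L) (ZMod q) p₂ p₁ with hw
  set f : CppConfig d L → ℝ := fun ω => if ω ∈ E then 1 else 0 with hf
  have hf₀ : 0 ≤ f := fun ω => by simp only [hf, Pi.zero_apply]; split_ifs <;> norm_num
  have hfmono : Monotone f := by
    intro a b hab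
    simp only [hf]
    by_cases ha : a ∈ E
    · rw [if_pos ha, if_pos (hE hab ha)]
    · rw [if_neg ha]; split_ifs <;> norm_num
  have hp₂c : p₂ ∈ Set.Icc (0 : ℝ) 1 := ⟨hp₂.1.le, hp₂.2.le⟩
  have hp₁c : p₁ ∈ Set.Icc (0 : ℝ) 1 := ⟨hp₁.1.le, hp₁.2.le⟩
  have key := cpp_positive_association q hp₂c hp₁c hf₀ hg₀ hfmono hgmono
  have hZ := cppPartitionFn_pos (d := d) (L := L) (ZMod q) hp₂ hp₁
  have hZ' := cppPartitionFn_pos (d := d) (L := L) (ZMod q) hp₂' hp₁'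
  -- rewrite both probabilities as ratios of `w`-sums
  have hL : cppEventProb (d := d) (L := L) (ZMod q) p₂ p₁ E =
      (∑ ω, w ω * f ω) / ∑ ω, w ω := by
    unfold cppEventProb cppProb cppPartitionFn
    rw [Finset.sum_div]
    refine Finset.sum_congr rfl fun ω _ => ?_
    simp only [hf]
    split_ifs <;> simp [hw]
  have hR : cppEventProb (d := d) (L := L) (ZMod q) p₂' p₁' E =
      (∑ ω, w ω * (f ω * g ω)) / ∑ ω, w ω * g ω := by
    unfold cppEventProb cppProb cppPartitionFn
    simp_rw [hww]
    rw [← Finset.mul_sum, Finset.sum_div]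
    refine Finset.sum_congr rfl fun ω _ => ?_
    by_cases hω : ω ∈ E
    · simp only [hf, if_pos hω, one_mul]
      rw [hw, mul_div_mul_left _ _ hKpos.ne']
    · simp only [hf, if_neg hω, zero_mul, mul_zero, zero_div]
  have hden : 0 < ∑ ω, w ω := hZ
  have hden' : 0 < ∑ ω, w ω * g ω := by
    have : K * ∑ ω, w ω * g ω = cppPartitionFn (d := d) (L := L) (ZMod q) p₂' p₁' := by
      unfold cppPartitionFn; rw [Finset.mul_sum]; exact Finset.sum_congr rfl fun ω _ => (hww ω).symm
    have h := hZ'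
    rw [← this] at h
    exact (mul_pos_iff_of_pos_left hKpos).mp h
  rw [hL, hR, div_le_div_iff₀ hden hden']
  calc (∑ ω, w ω * f ω) * (∑ ω, w ω * g ω) ≤ (∑ ω, w ω) * ∑ ω, w ω * (f ω * g ω) := key
    _ = (∑ ω, w ω * (f ω * g ω)) * ∑ ω, w ω := mul_comm _ _

/-- **Proposition 29 (Eldridge–Forsström–Schweinhart 2026): Wilson line∕loop expectations of the
Potts lattice Higgs model are increasing in `β₂` and in `β₁`**, `q` prime, on the torus, for
`0 < β₂ ≤ β₂'`, `0 < β₁ ≤ β₁'` and every `1`-chain `γ`: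
`𝔼_{μ_{β₂,β₁}}(W_γ) ≤ 𝔼_{μ_{β₂',β₁'}}(W_γ)`. Printed proof: `V_γ` is increasing, `ρ` is
stochastically increasing in `p₂, p₁` (Thm. 13) and `p = 1 - e^{-β}` is increasing in `β`; Thm. 7.
[cite: EldridgeForsstromSchweinhart2026, §5 Prop. 29] -/
theorem higgsExpect_wilsonLoopVar_mono {β₂ β₁ β₂' β₁' : ℝ} (hβ₂ : 0 < β₂) (hβ₁ : 0 < β₁)
    (h₂ : β₂ ≤ β₂') (h₁ : β₁ ≤ β₁') (γ : Site d L → Fin d → ZMod q) :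
    (higgsExpect (d := d) (L := L) (ZMod q) β₂ β₁ (wilsonLoopVar q γ)).re ≤
      (higgsExpect (d := d) (L := L) (ZMod q) β₂' β₁' (wilsonLoopVar q γ)).re := by
  rw [higgsExpect_wilsonLoopVar_re, higgsExpect_wilsonLoopVar_re]
  have hIoo : ∀ {β : ℝ}, 0 < β → esParam β ∈ Set.Ioo (0 : ℝ) 1 := fun {β} hβ =>
    ⟨by simp only [esParam, sub_pos]; exact Real.exp_lt_one_iff.mpr (by linarith),
      (esParam_mem_Ico hβ.le).2⟩
  have hmono : ∀ {β β' : ℝ}, β ≤ β' → esParam β ≤ esParam β' := fun {β β'} h => by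
    simp only [esParam, sub_le_sub_iff_left]
    exact Real.exp_le_exp.mpr (by linarith)
  exact cppEventProb_mono_param q (hIoo hβ₂) (hIoo hβ₁) (hIoo (hβ₂.trans_le h₂))
    (hIoo (hβ₁.trans_le h₁)) (hmono h₂) (hmono h₁)
    (fun ω ω' hle hω => IsRelNullHomologousIn.mono (ZMod q) hle hω)

end Monotone

end PlaquetteRC

end Literature.MathematicalPhysics.QuantumFieldTheory
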